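import Literature.Barriers.CriticalPhenomena.NoExactBlockRelationZ2
import Literature.Barriers.CriticalPhenomena.NoExactDominoRelationZ2
import HarnessLib

/-!
# Barrier (SAWScalingLimit): the block stencil contains the face, the vertex star and the domino — zero-extension

Kernel cross-check of the slot conventions of the square-lattice stencil catalogue, block edition
(companion of `NoExactPlusRelationZ2ZeroExtension`): the twelve block slots of
`NoExactBlockRelationZ2Instances` (`blockBase`/`blockDir`: slots `0–3` the four edges of the unit
square with lower-left corner `v`, counter-clockwise; `4–7` and `8–11` the two outward edges at each
corner) contain by zero-extension

* the face class `ExactPlaquetteRelationZ2` (Ikhlef–Cardy's shape) as the slots `0–3` verbatim,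
* the one-vertex class `ExactVertexRelationZ2` at the corner `v` as the slots `0` (`e₀`), `3`
  (the square edge `{v + e₁, v}`, traversed backwards), `4` (`-e₀`) and `8` (`-e₁`), and
* the domino class `ExactDominoRelationZ2` of `{v, v + e₀}` as the slots `0, 3, 4, 8` (at `v`) and
  `9` (`e₀`), `1` (`e₁`), `5` (`-e₁`) at `v + e₀`,

so the block no-go `exactBlockRelationZ2_eq_zero` re-derives the face, vertex and domino no-gos at
every real fugacity `x ≠ 0` (`exactBlockRelationZ2_iff_eq_zero` packages the block no-go itself as an
equivalence; the equivalences for the three sub-classes are in `NoExactPlusRelationZ2ZeroExtension`).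
No enumeration and no certificate is used in this file.

## What the sources print

Duminil-Copin–Smirnov, Ann. of Math. 175 (2012), Lemma 1 (one vertex, constant coefficients) and
Ikhlef–Cardy, J. Phys. A 42 (2009), §1, eq. (1) (the face contour sum) are the SHAPES whose
square-lattice counterparts with 4, 4, 7 and 12 free coefficients are compared here.
-/

noncomputable section

namespace Literature.Barriers.CriticalPhenomena

open Literature.Probability.RandomPlanarGeometry.SAW Literature.Probability.LatticeModels
  Literature.Probability.Percolation

/-- The fourth corner step of the unit square returns to the base corner: `v + e₁ - e₁ = v`. [folklore] -/
private theorem blk_corner_three (v : Site 2) : v + dirZ2 1 + dirZ2 3 = v := by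
  funext j; fin_cases j <;> simp [dirZ2, Matrix.vecHead, Matrix.vecTail]

/-- **Zero-extension: a face (plaquette) relation is a block relation** (block slots `0–3` are the
four edges of the square, in the plaquette class's own order and orientation).
[cite: IkhlefCardy2009, §1, eq. (1) (shape of the face relation)] -/
theorem exactBlockRelationZ2_of_plaquette {x σ : ℝ} {c : Fin 4 → ℂ} (h : ExactPlaquetteRelationZ2 x σ c) :
    ExactBlockRelationZ2 x σ ![c 0, c 1, c 2, c 3, 0, 0, 0, 0, 0, 0, 0, 0] := by
  intro Ω δ a v hδ ha hw hadj
  have hv := h Ω δ a v hδ ha hw (fun i => by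
    fin_cases i
    · simpa [blockBase, blockDir] using hadj 0
    · simpa [blockBase, blockDir] using hadj 1
    · simpa [blockBase, blockDir] using hadj 2
    · simpa [blockBase, blockDir] using hadj 3)
  unfold blockFunctionalZ2
  unfold plaquetteFunctionalZ2 at hv
  rw [Fin.sum_univ_four] at hv
  simp only [Fin.sum_univ_succ, Fin.sum_univ_zero]
  simp [blockBase, blockDir] at hv ⊢
  linear_combination hv

/-- **Zero-extension: a one-vertex relation at the corner `v` is a block relation** (edges at `v`:
block slots `0` (`e₀`), `3` (the square edge `{v + e₁, v}`), `4` (`-e₀`), `8` (`-e₁`)).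
[cite: DuminilCopinSmirnov2012, Lemma 1 (shape of the relation, one vertex)] -/
theorem exactBlockRelationZ2_of_vertex {x σ : ℝ} {c : Fin 4 → ℂ} (h : ExactVertexRelationZ2 x σ c) :
    ExactBlockRelationZ2 x σ ![c 0, 0, 0, c 1, c 2, 0, 0, 0, c 3, 0, 0, 0] := by
  intro Ω δ a v hδ ha hw hadj
  have hv := h Ω δ a v hδ ha hw (fun i => by
    fin_cases i
    · simpa [blockBase, blockDir, plaqCorner] using hadj 0
    · have h3 := hadj 3
      simp [blockBase, blockDir, plaqCorner] at h3
      rw [blk_corner_three] at h3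
      simpa using h3.symm
    · simpa [blockBase, blockDir, plaqCorner] using hadj 4
    · simpa [blockBase, blockDir, plaqCorner] using hadj 8)
  unfold blockFunctionalZ2
  rw [Fin.sum_univ_four] at hv
  simp only [Fin.sum_univ_succ, Fin.sum_univ_zero]
  simp [blockBase, blockDir, plaqCorner, blk_corner_three] at hv ⊢
  linear_combination hv

/-- **Zero-extension: a domino relation is a block relation** (the seven mid-edges adjacent to the
domino `{v, v + e₀}` = the bottom edge of the square: block slots `0, 3, 4, 8` at `v` and `9, 1, 5`
at `v + e₀`). [cite: DuminilCopinSmirnov2012, Lemma 1 (shape of the relation, one vertex)] -/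
theorem exactBlockRelationZ2_of_domino {x σ : ℝ} {c : Fin 7 → ℂ} (h : ExactDominoRelationZ2 x σ c) :
    ExactBlockRelationZ2 x σ ![c 0, c 5, 0, c 1, c 2, c 6, 0, 0, c 3, c 4, 0, 0] := by
  intro Ω δ a v hδ ha hw hadj
  have hv := h Ω δ a v hδ ha hw (fun k => by
    fin_cases k
    · simpa [blockBase, blockDir, plaqCorner, dominoBase, dominoDir] using hadj 0
    · have h3 := hadj 3
      simp [blockBase, blockDir, plaqCorner] at h3
      rw [blk_corner_three] at h3
      simpa [dominoBase, dominoDir] using h3.symm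
    · simpa [blockBase, blockDir, plaqCorner, dominoBase, dominoDir] using hadj 4
    · simpa [blockBase, blockDir, plaqCorner, dominoBase, dominoDir] using hadj 8
    · simpa [blockBase, blockDir, plaqCorner, dominoBase, dominoDir] using hadj 9
    · simpa [blockBase, blockDir, plaqCorner, dominoBase, dominoDir] using hadj 1
    · simpa [blockBase, blockDir, plaqCorner, dominoBase, dominoDir] using hadj 5)
  unfold blockFunctionalZ2
  unfold dominoFunctionalZ2 at hv
  rw [Fin.sum_univ_seven] at hv
  simp only [Fin.sum_univ_succ, Fin.sum_univ_zero]
  simp [blockBase, blockDir, plaqCorner, dominoBase, dominoDir, blk_corner_three] at hv ⊢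
  linear_combination hv

/-- **The block relation class is trivial at every real fugacity `x ≠ 0` and every spin**
(`exactBlockRelationZ2_eq_zero` and `exactBlockRelationZ2_zero` as one equivalence).
[cite: DuminilCopinSmirnov2012, Lemma 1 (shape of the relation; twelve-slot square-lattice counterpart holds only with zero coefficients)] -/
theorem exactBlockRelationZ2_iff_eq_zero {x σ : ℝ} (hx : x ≠ 0) (c : Fin 12 → ℂ) :
    ExactBlockRelationZ2 x σ c ↔ c = 0 :=
  ⟨exactBlockRelationZ2_eq_zero hx, by rintro rfl; exact exactBlockRelationZ2_zero x σ⟩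

end Literature.Barriers.CriticalPhenomena
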